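import Summits.QuantumFields.QCD.Theorems.HeatSlicedQuarksRobustYangMillsHandoverStubFermiIntegralBilinearCyclicSupertrace
import HarnessLib

/-!
# Stub `stub_qcdTorusExpect_bilinear_eq_cyclic_ratio` of line `pin-the-infimum`
(crux `RobustYangMillsHandover`, 8892)

E2 (fermionic insertions in Lüscher's transfer form), layer E2-d(1'): **the torus expectation of
ONE equal-time quark bilinear as a RATIO of cyclic kernel supertrace integrals.**

For an `SU(3)` gauge field on the four-torus `(ℤ/L)⁴`, `N_f` flavours of `r = 1` Wilson quarks with
masses `mq f > −1`, a slice `t₀` and a source block `Jh` on the quark variables of that slice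
(torus-level equal-time source `Jt t₀ Jh`), write `cyc Q` for the cyclic kernel supertrace
integral with slot insertions `Q i (Us i)` in front of the slice-`i` factor `T̂_F(Us i) Γ(G_{gs i})`,
and `ε = (−1)^{n(n−1)/2 + n}` (`n` = number of quark variables).

(1) `∫ e^{−β S_W(U)} ∫dψ̄dψ (ψ̄ Jt ψ) e^{−ψ̄D(U)ψ} ∏_e dU_e = ε · cyc 𝒦`, with `𝒦 i V = ins V Jh` on
the slice `i = t₀` and `1` otherwise: this is conjunct (b) of the landed one-insertion theorem
`stub_fermiIntegral_bilinear_cyclic_supertrace`, whose insertion is evaluated at `Us t₀`; slot by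
slot the insertion evaluated at `Us t₀` is the insertion evaluated at `Us i` on the slice `i = t₀`
(`StubQcdTorusExpectBilinearEqCyclicRatio.slot_eq`).

(2) `qcdTorusExpect β L mq (ψ̄ Jt ψ) = cyc 𝒦 / cyc 1`: numerator and denominator of the torus
functional are Wilson-measure integrals, i.e. Haar integrals divided by `Z_W`
(`TorusDenominator.integral_wilsonMeasure_eq_div`); the numerator is (1), the denominator is
`ε · cyc 1` (`fermiIntegral_fermiBoltzmann` and the `N_f`-flavour capstone C
`qcd_boltzmann_integral_eq_cyclic_supertrace_flavour`); `Z_W ≠ 0` and `ε ≠ 0` cancel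
(`div_div_div_cancel_right₀`, `mul_div_mul_left`) — the meson one-point function at kernel level
(it enters the connected correlator as `⟨A⟩⟨B⟩`).

Pure theorem file (no definitions).  References: M. Lüscher, Comm. Math. Phys. 54 (1977) 283–292;
K. Osterwalder, E. Seiler, Ann. Phys. 110 (1978) 440, §2; I. Montvay, G. Münster, *Quantum Fields
on a Lattice* (CUP 1994), §4.1 (4.14)–(4.17), §5.1; J. Smit, *Introduction to Quantum Fields on a
Lattice* (CUP 2002/2023), §4.6, §6.5 (6.91).
-/

noncomputable section

namespace Summit.QuantumFields.QCD.Cruxes.RobustYangMillsHandover.PinTheInfimum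

open Literature.MathematicalPhysics.QuantumLattice Literature.MathematicalPhysics.QuantumFieldTheory
open Literature.Probability.LatticeModels (TorusSite)
open MeasureTheory
open Summit.QuantumFields.QCD.Cruxes.StableActionBridge.Sketch

namespace StubQcdTorusExpectBilinearEqCyclicRatio

/-- **Slot matching.**  In slot `c` of the time-ordered product, the insertion evaluated at the
configuration `U t₀` of its own slice agrees with the insertion evaluated at the configuration
`U c` of the running slice (the `if` only fires on `c = t₀`).  The right-hand side is written as a
dependent `if` so that `simp` does not treat the identity as a permutation lemma; `dite_eq_ite`
folds it back. [folklore] -/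
theorem slot_eq {ι G J M : Type*} [DecidableEq ι] (ins : G → J → M) (U : ι → G) (c t₀ : ι)
    (Jh : J) (E : M) :
    (if c = t₀ then ins (U t₀) Jh else E) = (if _h : c = t₀ then ins (U c) Jh else E) := by
  split_ifs with h
  · rw [h]
  · rfl

end StubQcdTorusExpectBilinearEqCyclicRatio

-- The registered signature feeds `qcdTorusExpect` the Grassmann-valued observable `fun U => ψ̄ Jt ψ`,
-- which does not depend on the gauge field `U`, so `linter.unusedVariables` reports that binder for every
-- proof; the linter is switched off for this one declaration only.
set_option linter.unusedVariables false in
/-- **E2-d(1'): the torus expectation of ONE equal-time quark bilinear as a ratio of cyclic kernel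
supertrace integrals.**  For `SU(3)` gauge fields on `(ℤ/L)⁴`, `N_f` flavours of `r = 1` Wilson
quarks with masses `mq f > −1`, a slice `t₀` and a source block `Jh` (torus-level equal-time source
`Jt t₀ Jh`), `cyc Q` the cyclic kernel supertrace integral with slot insertions `Q i (Us i)` and
`ε = (−1)^{n(n−1)/2 + n}`:
(1) `∫ e^{−β S_W} ∫dψ̄dψ (ψ̄ Jt ψ) e^{−ψ̄Dψ} dU = ε · cyc 𝒦` with the link-free insertion
`𝒦_i(V) = ins V Jh` on the slice `i = t₀` (`1` otherwise) — the landed one-insertion cyclic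
supertrace identity, read slot by slot;
(2) `⟨ψ̄ Jt ψ⟩_{β,L,mq} = cyc 𝒦 / cyc 1` — the orientation sign `ε` and the pure-gauge partition
function `Z_W` cancel between numerator and denominator: Lüscher's transfer form of the meson
one-point function at kernel level (registered stub signature verbatim, header on one line).
[cite: Luscher1977, pp. 283–292] [cite: OsterwalderSeiler1978, §2] -/
theorem stub_qcdTorusExpect_bilinear_eq_cyclic_ratio : ∀ (Nf L : ℕ) [NeZero L] (β : ℝ) (mq : Fin Nf → ℝ), (∀ f, -1 < mq f) → ∀ (t₀ : ZMod L) (Jh : Matrix (SliceQuarkVar Nf L) (SliceQuarkVar Nf L) ℂ), let Jt : ZMod L → Matrix (SliceQuarkVar Nf L) (SliceQuarkVar Nf L) ℂ → Matrix (FermiIdx Nf L) (FermiIdx Nf L) ℂ := fun t J => Matrix.reindex quarkEquiv quarkEquiv (Matrix.of fun v w : QuarkVar Nf L => if v.2.1 0 = t ∧ w.2.1 0 = t then J (v.1, (Fin.tail v.2.1, v.2.2)) (w.1, (Fin.tail w.2.1, w.2.2)) else 0); let ins : GaugeConfig 3 L (Matrix.specialUnitaryGroup (Fin 3) ℂ)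 → Matrix (SliceQuarkVar Nf L) (SliceQuarkVar Nf L) ℂ → Matrix (Finset (SliceFermiIdx Nf L)) (Finset (SliceFermiIdx Nf L)) ℂ := fun V J => dGamma (Matrix.reindex sliceQuarkEquiv sliceQuarkEquiv (sliceKron (Nf := Nf) (S := L) 1 (gammaFive * euclideanGamma 0) * ((-sliceKron (Nf := Nf) (S := L) 1 timeProjPlus + sliceKron (Nf := Nf) (S := L) 1 timeProjPlus * (sliceKron (Nf := Nf) (S := L) 1 (euclideanGamma 0) * sliceDiracKinetic V) * sliceKron ((sliceMassHop V mq)⁻¹) 1 * sliceKron (Nf := Nf) (S := L) 1 timeProjMinus + sliceKron ((sliceMassHop V mq)⁻¹) 1 * sliceKron (Nf := Nf) (S := L) 1 timeProjMinus) * J * (sliceKron (Nf := Nf) (S := L) 1 timeProjMinus + sliceKron (Nf := Nf) (S := L) 1 timeProjPlus * (sliceKron (Nf := Nf) (S := L) 1 (euclideanGamma 0 * gammaFive) * (fermionSliceMatrix V mq)⁻¹ * sliceKron (Nf := Nf) (S := L) 1 (gammaFive * euclideanGamma 0)))) * sliceKron (Nf := Nf) (S := L) 1 (euclideanGamma 0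 * gammaFive))) - (J * sliceKron ((sliceMassHop V mq)⁻¹) 1 * sliceKron (Nf := Nf) (S := L) 1 timeProjMinus).trace • (1 : Matrix (Finset (SliceFermiIdx Nf L)) (Finset (SliceFermiIdx Nf L)) ℂ); let cyc : (ℕ → GaugeConfig 3 L (Matrix.specialUnitaryGroup (Fin 3) ℂ) → Matrix (Finset (SliceFermiIdx Nf L)) (Finset (SliceFermiIdx Nf L)) ℂ) → ℂ := fun Q => ∫ p : (ZMod L → GaugeConfig 3 L (Matrix.specialUnitaryGroup (Fin 3) ℂ)) × (ZMod L → TorusSite 3 L → Matrix.specialUnitaryGroup (Fin 3) ℂ), ((∏ t : ZMod L, gaugeSliceKernel β (p.1 t) (gaugeTransform (p.2 t) (p.1 (t + 1))) : ℝ) : ℂ) * ∑ S : Finset (SliceFermiIdx Nf L), (-1 : ℂ) ^ S.card * (((List.range L).map fun i : ℕ => Q i (p.1 (i : ZMod L)) * (fermionSliceOp (p.1 (i : ZMod L)) mq * fockGaugeAct (Nf := Nf) (p.2 (i : ZMod L)))).prod) S S ∂((Measure.pi fun _ : ZMod L => Measure.pi fun _ : Edge 3 L => haarProbability (Matrix.specialUnitaryGroup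 (Fin 3) ℂ)).prod (Measure.pi fun _ : ZMod L => Measure.pi fun _ : TorusSite 3 L => haarProbability (Matrix.specialUnitaryGroup (Fin 3) ℂ))); ∫ U : GaugeConfig 4 L (Matrix.specialUnitaryGroup (Fin 3) ℂ), (Real.exp (-(β * wilsonAction (fundamentalRep (Fin 3)) U)) : ℂ) * fermiIntegral (quadratic ℂ (Jt t₀ Jh) * fermiBoltzmann U mq) ∂(Measure.pi fun _ : Edge 4 L => haarProbability (Matrix.specialUnitaryGroup (Fin 3) ℂ)) = (-1 : ℂ) ^ (Fintype.card (FermiIdx Nf L) * (Fintype.card (FermiIdx Nf L) - 1) / 2 + Fintype.card (FermiIdx Nf L)) * cyc (fun i V => if (i : ZMod L) = t₀ then ins V Jh else 1) ∧ qcdTorusExpect β L mq (fun U => quadratic ℂ (Jt t₀ Jh)) = cyc (fun i V => if (i : ZMod L) = t₀ then ins V Jh else 1) / cyc (fun _ _ => 1) := by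
  intro Nf L _ β mq hm t₀ Jh Jt ins cyc
  /- the landed one-insertion theorem, its `let`s merged with ours -/
  have h := stub_fermiIntegral_bilinear_cyclic_supertrace Nf L β mq hm t₀ Jh
  extract_lets at h
  refine StubFermiIntegralBilinearCyclicSupertrace.and_of_imp ?_ fun h1 => ?_
  · /- (1): conjunct (b) of the one-insertion theorem, slot by slot. -/
    dsimp only [cyc]
    rw [h.2]
    refine congrArg (HMul.hMul _) (integral_congr_ae (ae_of_all _ fun p => ?_))
    dsimp only
    simp only [StubQcdTorusExpectBilinearEqCyclicRatio.slot_eq ins p.1, dite_eq_ite]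
  · /- (2): Wilson-measure integrals as Haar quotients; the numerator is (1), the denominator is
      `ε · cyc 1` (Berezin Gaussian formula and capstone C); cancel `Z_W` and `ε`. -/
    unfold qcdTorusExpect
    simp only [fermiIntegral_fermiBoltzmann]
    rw [TorusDenominator.integral_wilsonMeasure_eq_div (continuous_fundamentalRep (Fin 3)) β,
      TorusDenominator.integral_wilsonMeasure_eq_div (continuous_fundamentalRep (Fin 3)) β,
      div_div_div_cancel_right₀ (GluonicExpectation.ofReal_integral_exp_wilsonAction_ne_zero L β),
      GluonicExpectation.integral_weight_mul_const_mul, h1,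
      mul_div_mul_left _ _ (fermiOrientationSign_ne_zero _),
      qcd_boltzmann_integral_eq_cyclic_supertrace_flavour Nf L β mq hm]
    simp only [cyc, one_mul]

end Summit.QuantumFields.QCD.Cruxes.RobustYangMillsHandover.PinTheInfimum

end
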